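import Summits.Ventures.HSemireg.PhaseTorusLaw

/-!
# Phase-torus law on `(μ₄)⁴`, proof: box covering, value-table bumps, product certificate ⇒ `phaseTorusLaw_holds`
# (HSemireg support file, second of two; «control» lens g5, LINE for idea-crit-6, 2026-08-29)

Sequel of `Summits/Ventures/HSemireg/PhaseTorusLaw.lean` (definitions `PT`, `chi`, `KAdm`, `moment`, `PhaseTorusLaw`,
`NonOpp`, `CoveringLemma`; the covering lemma `coveringLemma_holds`; PART C = the character calculus on `(ℤ/4)⁴`).
This file: PART A (box form of the covering), PART B (the bumps `bumpPair` = (0,0,2,2), `bumpFree` = (3/2,1,1/2,1) by value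
table with their three-term character expansions), PART D (the product certificate `F_w = Π_f φ_f`, one rotation
`rot_step`, and **`phaseTorusLaw_holds : PhaseTorusLaw`** by the four rotations `w = 0,1,2,3`).
Nothing in this file proves HC, HC_AV, HC_CM, H2 or item 18881; census-neutral. Everything PROVED (axioms `propext`,
`Classical.choice`, `Quot.sound`); no `sorry`, no named fact (the one `def … : Prop`, `CoveringLemmaBox`, is proved in-file),
no instance, no notation. Statements: control g5 (crux workfile `Cruxes/BlochSeedDiscOne/PhaseTorusLaw.lean` v3 spec);
proofs: s4-prove-1 g32. The design-level dictionary (M)(T) is NOT here (crux workfile `LinePhaseTorus.lean`, spec).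

Pen proof being typed (memo `Cruxes/BlochSeedDiscOne/PHASE-TORUS-LAW-g5.md` §2 (C)(P)): at most four points `A ⊆ (μ₄)⁴`
are boxed by a free coordinate `f₀` and adjacent pairs `{s_f, s_f + 1}` on the others; `F_w(τ) = φ^{free}_w(τ_{f₀}) ·
Π_{f ≠ f₀} φ^{pair}_{s_f}(τ_f) ≥ 0` vanishes on `A`, has no frequency-`2` component, and `Σ_τ ω(τ)F_w(τ) = 2 Re(c₁(w) μ)`
with `c₁(w) = e(−w)/4 · P`, `P ≠ 0`; since `ω ≤ 0` off `A` the pairing is `≤ 0` for the four rotations, whence `μ = 0`.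
-/

namespace Summit.Ventures.HSemireg.PhaseTorus

open Finset BigOperators

/-! ## PARTS A·B·D — box covering, value-table bumps, product certificate ⇒ `phaseTorusLaw_holds`
(SPEC by control g5; signatures FIXED; bodies = s4-prove-1 g32).
PLAN.  (A) BOX COVERING from `coveringLemma_holds`: the values hosted on one coordinate are pairwise `NonOpp`,
hence lie in an adjacent pair `{s, s+1}` (`exists_pair_cover`, 16 subsets, `decide`).  (B) BUMPS BY VALUE TABLE:
`bumpPair s` = (0,0,2,2) on (s, s+1, s+2, s+3) = `1 + Re(z_s · conj(i^t))`, `z_s = (−1−i)·i^s`; `bumpFree w` =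
(3/2, 1, 1/2, 1) on (w, w+1, w+2, w+3) = `1 + ½ Re(conj(i^w) i^t)`; each is a 3-term character sum with the
coefficient tables `coefPair`, `coefFree` (zero at frequency 2) — pointwise identities, 16 cases each (`fin_cases`; `norm_num`).
(D) ASSEMBLY: `F_w(τ) = Π_f φ_f(τ f)` (φ_{f₀} = bumpFree w, φ_f = bumpPair (s f) otherwise; `Fin.prod_univ_four`);
`F_w ≥ 0`, `F_w|_A = 0`, so `Σ_τ ω τ · F_w τ ≤ 0`; by `pairing_expansion` it equals `Σ_k c_k(w) · moment ω k` with
`c_k(w) = 0` when some `k f = 2` (`coefPair_two`, `coefFree_two`), `moment ω k = 0` for `KAdm k`, leaving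
`c₁(w) μ + c₃(w) μ̄ = 2 Re(c₁(w) μ)` (`moment_three_eq_conj_moment_one`), `c₁(w) = P · i^{−w}/4`, `P = Π_{f ≠ f₀} conj(z_{s f})/2 ≠ 0`
(`zPair_ne_zero`); the four inequalities (w = 0,1,2,3) give `Re(Pμ) = Im(Pμ) = 0`, so `μ = 0`. -/


/-! ## (A) box covering -/

/-- pairwise non-opposite values of `ℤ/4` lie in an adjacent pair. -/
theorem exists_pair_cover (V : Finset (ZMod 4)) (h : ∀ x ∈ V, ∀ y ∈ V, NonOpp x y) :
    ∃ s : ZMod 4, ∀ x ∈ V, x = s ∨ x = s + 1 := by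
  revert h; revert V; unfold NonOpp; decide

/-- Box form of the covering lemma: a free coordinate `f₀` and hosting pairs `{s f, s f + 1}`. -/
def CoveringLemmaBox : Prop :=
  ∀ A : Finset PT, A.card ≤ 4 →
    ∃ f₀ : Fin 4, ∃ s : Fin 4 → ZMod 4, ∀ a ∈ A, ∃ f, f ≠ f₀ ∧ (a f = s f ∨ a f = s f + 1)

/-- **The box covering holds** for every `A` with at most four points (from `coveringLemma_holds` and `exists_pair_cover`). -/
theorem coveringLemmaBox_holds : CoveringLemmaBox := by
  intro A hA
  obtain ⟨f₀, g, hgf, hg⟩ := coveringLemma_holds A hA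
  -- on each coordinate the hosted values are pairwise non-opposite, hence inside an adjacent pair
  have hwin : ∀ f, ∃ s : ZMod 4, ∀ a ∈ A, g a = f → a f = s ∨ a f = s + 1 := by
    intro f
    obtain ⟨s, hs⟩ := exists_pair_cover ((A.filter (fun a => g a = f)).image (fun a => a f)) (by
      intro x hx y hy
      simp only [Finset.mem_image, Finset.mem_filter] at hx hy
      obtain ⟨a, ⟨ha, hga⟩, rfl⟩ := hx
      obtain ⟨b, ⟨hb, hgb⟩, rfl⟩ := hy
      have h := hg a ha b hb (hga.trans hgb.symm)
      rw [hga] at h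
      exact h)
    exact ⟨s, fun a ha hga => hs (a f) (Finset.mem_image.2 ⟨a, Finset.mem_filter.2 ⟨ha, hga⟩, rfl⟩)⟩
  choose s hs using hwin
  exact ⟨f₀, s, fun a ha => ⟨g a, hgf a ha, hs (g a) a ha rfl⟩⟩

/-! ## (B) bumps by value table and their character expansions -/

/-- adjacent-pair bump: vanishes exactly on `{s, s+1}`, value `2` elsewhere. -/
noncomputable def bumpPair (s t : ZMod 4) : ℝ := if t = s ∨ t = s + 1 then 0 else 2

/-- free bump with phase `w`: values `3/2, 1, 1/2, 1` at `w, w+1, w+2, w+3` (strictly positive). -/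
noncomputable def bumpFree (w t : ZMod 4) : ℝ :=
  if t = w then 3 / 2 else if t = w + 2 then 1 / 2 else 1

/-- `z_s = (−1 − i)·i^s`. -/
noncomputable def zPair (s : ZMod 4) : ℂ := (-1 - Complex.I) * Complex.I ^ s.val

/-- frequency table of `bumpPair s`: `1` at `0`, `conj z_s / 2` at `1`, `z_s / 2` at `3`, `0` at `2`. -/
noncomputable def coefPair (s j : ZMod 4) : ℂ :=
  if j = 0 then 1 else if j = 1 then (starRingEnd ℂ) (zPair s) / 2 else if j = 3 then zPair s / 2 else 0

/-- frequency table of `bumpFree w`: `1` at `0`, `i^{−w}/4` at `1`, `i^{w}/4` at `3`, `0` at `2`. -/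
noncomputable def coefFree (w j : ZMod 4) : ℂ :=
  if j = 0 then 1 else if j = 1 then Complex.I ^ (-w).val / 4
  else if j = 3 then Complex.I ^ w.val / 4 else 0


/-! #### PART B helpers (s4-prove-1 g32): the Re-form `1 + 2 Re(a·e t)` of a three-term character sum, the
hosting coefficient `κ = (−1+i)/2 = conj(z_0)/2`, values by cases on `t − s` -/

/-- The real phase bump `1 + 2 Re(a·e(t))` (Re-form of `1 + a·e(t) + ā·ē(t)`). -/
noncomputable def bump (a : ℂ) (t : ZMod 4) : ℝ := 1 + 2 * (a * e t).re

/-- `1 + a·e t + ā·e(3t) = 1 + 2 Re(a·e t)` (as a complex number). -/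
theorem three_term_eq_bump (a : ℂ) (t : ZMod 4) :
    (1 : ℂ) + a * e t + (starRingEnd ℂ) a * e (3 * t) = (bump a t : ℂ) := by
  unfold bump
  rw [e_three_mul, add_assoc, ← map_mul, Complex.add_conj]
  push_cast
  ring

/-- The hosting coefficient `κ = (-1 + i)/2`. -/
noncomputable def κ : ℂ := (-1 + Complex.I) / 2

/-- `κ ≠ 0`. -/
theorem κ_ne_zero : κ ≠ 0 := by
  intro h
  have := congrArg Complex.re h
  norm_num [κ] at this

/-- `Re κ = -1/2`. -/
theorem re_κ_one : (κ * 1).re = -(1 / 2 : ℝ) := by norm_num [κ]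

/-- `Re (κ i) = -1/2`. -/
theorem re_κ_I : (κ * Complex.I).re = -(1 / 2 : ℝ) := by norm_num [κ]

/-- `Re (-κ) = 1/2`. -/
theorem re_κ_neg_one : (κ * -1).re = (1 / 2 : ℝ) := by norm_num [κ]

/-- `Re (-κ i) = 1/2`. -/
theorem re_κ_neg_I : (κ * -Complex.I).re = (1 / 2 : ℝ) := by norm_num [κ]

/-- `conj(z_s)/2 = κ · conj(e s)`. -/
theorem conj_zPair_div_two (s : ZMod 4) : (starRingEnd ℂ) (zPair s) / 2 = κ * (starRingEnd ℂ) (e s) := by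
  unfold zPair κ
  rw [map_mul, map_sub, map_neg, map_one, Complex.conj_I]
  change (-1 - -Complex.I) * (starRingEnd ℂ) (e s) / 2 = _
  ring

/-- The argument of the hosting bump at `s` evaluated at `t` is `e (t - s)`. -/
theorem host_arg (s t : ZMod 4) : κ * (starRingEnd ℂ) (e s) * e t = κ * e (t - s) := by
  rw [sub_eq_add_neg, e_add, e_neg]; ring

/-- `2 + s ∉ {s, s + 1}` in `ℤ/4`. -/
theorem two_add_facts (s : ZMod 4) : ¬((2 : ZMod 4) + s = s ∨ (2 : ZMod 4) + s = s + 1) := by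
  revert s; decide

/-- `3 + s ∉ {s, s + 1}` in `ℤ/4`. -/
theorem three_add_facts (s : ZMod 4) : ¬((3 : ZMod 4) + s = s ∨ (3 : ZMod 4) + s = s + 1) := by
  revert s; decide

/-- `1 + s ≠ s` in `ℤ/4`. -/
theorem one_add_ne (s : ZMod 4) : (1 : ZMod 4) + s ≠ s := by revert s; decide

/-- `1 + s ≠ s + 2` in `ℤ/4`. -/
theorem one_add_ne_add_two (s : ZMod 4) : (1 : ZMod 4) + s ≠ s + 2 := by revert s; decide

/-- `3 + s ≠ s` in `ℤ/4`. -/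
theorem three_add_ne (s : ZMod 4) : (3 : ZMod 4) + s ≠ s := by revert s; decide

/-- `3 + s ≠ s + 2` in `ℤ/4`. -/
theorem three_add_ne_add_two (s : ZMod 4) : (3 : ZMod 4) + s ≠ s + 2 := by revert s; decide

/-- `2 + s ≠ s` in `ℤ/4`. -/
theorem two_add_ne (s : ZMod 4) : (2 : ZMod 4) + s ≠ s := by revert s; decide

/-- The hosting bump in Re-form IS the value table `bumpPair`. -/
theorem bump_host_eq_bumpPair (s t : ZMod 4) : bump (κ * (starRingEnd ℂ) (e s)) t = bumpPair s t := by
  unfold bump bumpPair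
  rw [host_arg]
  obtain ⟨d, rfl⟩ : ∃ d, t = d + s := ⟨t - s, (sub_add_cancel t s).symm⟩
  rw [add_sub_cancel_right]
  have h4 : ∀ y : ZMod 4, y = 0 ∨ y = 1 ∨ y = 2 ∨ y = 3 := by decide
  rcases h4 d with rfl | rfl | rfl | rfl
  · rw [zero_add, e_zero, re_κ_one, if_pos (Or.inl rfl)]; norm_num
  · rw [e_one, re_κ_I, if_pos (Or.inr (add_comm _ _))]; norm_num
  · rw [e_two, re_κ_neg_one, if_neg (two_add_facts s)]; norm_num
  · rw [e_three, re_κ_neg_I, if_neg (three_add_facts s)]; norm_num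

/-- The free bump in Re-form IS the value table `bumpFree`. -/
theorem bump_free_eq_bumpFree (w t : ZMod 4) : bump (e (-w) / 4) t = bumpFree w t := by
  unfold bump bumpFree
  have harg : e (-w) / 4 * e t = e (t - w) / 4 := by rw [sub_eq_add_neg, e_add]; ring
  rw [harg]
  obtain ⟨d, rfl⟩ : ∃ d, t = d + w := ⟨t - w, (sub_add_cancel t w).symm⟩
  rw [add_sub_cancel_right]
  have h4 : ∀ y : ZMod 4, y = 0 ∨ y = 1 ∨ y = 2 ∨ y = 3 := by decide
  rcases h4 d with rfl | rfl | rfl | rfl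
  · rw [zero_add, e_zero, if_pos rfl]; norm_num
  · rw [e_one, if_neg (one_add_ne w), if_neg (one_add_ne_add_two w)]; norm_num
  · rw [e_two, if_neg (two_add_ne w), if_pos (add_comm _ _)]; norm_num
  · rw [e_three, if_neg (three_add_ne w), if_neg (three_add_ne_add_two w)]; norm_num

/-- `coefPair s 0 = 1`. -/
theorem coefPair_zero (s : ZMod 4) : coefPair s 0 = 1 := by simp [coefPair]

/-- `coefPair s 1 = conj z_s / 2`. -/
theorem coefPair_one (s : ZMod 4) : coefPair s 1 = (starRingEnd ℂ) (zPair s) / 2 := by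
  simp [coefPair, show (1 : ZMod 4) ≠ 0 from by decide]

/-- `coefPair s 3 = z_s / 2`. -/
theorem coefPair_three (s : ZMod 4) : coefPair s 3 = zPair s / 2 := by
  simp [coefPair, show (3 : ZMod 4) ≠ 0 from by decide, show (3 : ZMod 4) ≠ 1 from by decide]

/-- `coefFree w 0 = 1`. -/
theorem coefFree_zero (w : ZMod 4) : coefFree w 0 = 1 := by simp [coefFree]

/-- `coefFree w 1 = e (-w) / 4`. -/
theorem coefFree_one (w : ZMod 4) : coefFree w 1 = e (-w) / 4 := by
  simp [coefFree, e, show (1 : ZMod 4) ≠ 0 from by decide]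

/-- `coefFree w 3 = e w / 4`. -/
theorem coefFree_three (w : ZMod 4) : coefFree w 3 = e w / 4 := by
  simp [coefFree, e, show (3 : ZMod 4) ≠ 0 from by decide, show (3 : ZMod 4) ≠ 1 from by decide]

/-- `coefPair s 3 = conj (coefPair s 1)` and `coefFree w 3 = conj (coefFree w 1)` (real bumps). -/
theorem coefPair_three_eq_conj (s : ZMod 4) : coefPair s 3 = (starRingEnd ℂ) (coefPair s 1) := by
  rw [coefPair_three, coefPair_one, map_div₀, Complex.conj_conj]
  congr 1
  exact (Complex.conj_ofNat 2).symm

/-- `coefFree w 3 = conj (coefFree w 1)` (the free bump is real). -/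
theorem coefFree_three_eq_conj (w : ZMod 4) : coefFree w 3 = (starRingEnd ℂ) (coefFree w 1) := by
  rw [coefFree_three, coefFree_one, map_div₀, ← e_neg, neg_neg]
  congr 1
  exact (Complex.conj_ofNat 4).symm


/-- `bumpPair s t ≥ 0`. -/
theorem bumpPair_nonneg (s t : ZMod 4) : 0 ≤ bumpPair s t := by
  unfold bumpPair; split_ifs <;> norm_num

/-- `bumpPair s` vanishes on `{s, s + 1}`. -/
theorem bumpPair_eq_zero {s t : ZMod 4} (h : t = s ∨ t = s + 1) : bumpPair s t = 0 := by
  unfold bumpPair; rw [if_pos h]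

/-- `bumpFree w t > 0`. -/
theorem bumpFree_pos (w t : ZMod 4) : 0 < bumpFree w t := by
  unfold bumpFree; split_ifs <;> norm_num

/-- The pair bump has no frequency-`2` term. -/
theorem coefPair_two (s : ZMod 4) : coefPair s 2 = 0 := by
  simp [coefPair, show (2 : ZMod 4) ≠ 0 from by decide, show (2 : ZMod 4) ≠ 1 from by decide,
    show (2 : ZMod 4) ≠ 3 from by decide]

/-- The free bump has no frequency-`2` term. -/
theorem coefFree_two (w : ZMod 4) : coefFree w 2 = 0 := by
  simp [coefFree, show (2 : ZMod 4) ≠ 0 from by decide, show (2 : ZMod 4) ≠ 1 from by decide,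
    show (2 : ZMod 4) ≠ 3 from by decide]

/-- **Character expansion of the pair bump** (pointwise on `ℤ/4`). -/
theorem bumpPair_expand (s t : ZMod 4) :
    (bumpPair s t : ℂ) = ∑ j : ZMod 4, coefPair s j * Complex.I ^ ((j * t).val) := by
  change _ = ∑ j : ZMod 4, coefPair s j * e (j * t)
  rw [sum_univ_zmod4, coefPair_zero, coefPair_one, coefPair_two, coefPair_three_eq_conj, coefPair_one, zero_mul,
    e_zero, one_mul, one_mul, zero_mul, add_zero, three_term_eq_bump, conj_zPair_div_two, bump_host_eq_bumpPair]

/-- **Character expansion of the free bump** (pointwise on `ℤ/4`). -/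
theorem bumpFree_expand (w t : ZMod 4) :
    (bumpFree w t : ℂ) = ∑ j : ZMod 4, coefFree w j * Complex.I ^ ((j * t).val) := by
  change _ = ∑ j : ZMod 4, coefFree w j * e (j * t)
  rw [sum_univ_zmod4, coefFree_zero, coefFree_two, coefFree_three_eq_conj, coefFree_one, zero_mul, e_zero,
    one_mul, one_mul, zero_mul, add_zero, three_term_eq_bump, bump_free_eq_bumpFree]

/-- `z_s ≠ 0`. -/
theorem zPair_ne_zero (s : ZMod 4) : zPair s ≠ 0 := by
  unfold zPair
  refine mul_ne_zero (fun h => ?_) (e_ne_zero s)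
  have := congrArg Complex.re h
  norm_num at this

/-! ## (D) assembly -/

/-! #### PART D helpers (s4-prove-1 g32): the coefficient∕value vectors of `F_w`, the reduced pairing, one rotation -/

/-- Coefficient tables of `F_w`: the free bump on `f₀`, hosting bumps at `s f` elsewhere. -/
noncomputable def cvec (f₀ : Fin 4) (w : ZMod 4) (s : Fin 4 → ZMod 4) (f : Fin 4) : ZMod 4 → ℂ :=
  if f = f₀ then coefFree w else coefPair (s f)

/-- Value of the factor `φ_f` of `F_w` at `t`. -/
noncomputable def vvec (f₀ : Fin 4) (w : ZMod 4) (s : Fin 4 → ZMod 4) (f : Fin 4) (t : ZMod 4) : ℝ :=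
  if f = f₀ then bumpFree w t else bumpPair (s f) t

/-- No factor of `F_w` has a frequency-`2` term. -/
theorem cvec_two (f₀ : Fin 4) (w : ZMod 4) (s : Fin 4 → ZMod 4) (f : Fin 4) : cvec f₀ w s f 2 = 0 := by
  unfold cvec; split_ifs
  · exact coefFree_two w
  · exact coefPair_two _

/-- Frequency `3` is the conjugate of frequency `1` in every factor (all factors are real). -/
theorem cvec_three (f₀ : Fin 4) (w : ZMod 4) (s : Fin 4 → ZMod 4) (f : Fin 4) :
    cvec f₀ w s f 3 = (starRingEnd ℂ) (cvec f₀ w s f 1) := by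
  unfold cvec; split_ifs
  · exact coefFree_three_eq_conj w
  · exact coefPair_three_eq_conj _

/-- Every factor of `F_w` is non-negative. -/
theorem vvec_nonneg (f₀ : Fin 4) (w : ZMod 4) (s : Fin 4 → ZMod 4) (f : Fin 4) (t : ZMod 4) :
    0 ≤ vvec f₀ w s f t := by
  unfold vvec; split_ifs
  · exact (bumpFree_pos w t).le
  · exact bumpPair_nonneg _ t

/-- each factor's trigonometric polynomial is the real value `vvec`. -/
theorem trig_cvec (f₀ : Fin 4) (w : ZMod 4) (s : Fin 4 → ZMod 4) (f : Fin 4) (t : ZMod 4) :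
    ∑ j : ZMod 4, cvec f₀ w s f j * Complex.I ^ ((j * t).val) = (vvec f₀ w s f t : ℂ) := by
  unfold cvec vvec; split_ifs
  · exact (bumpFree_expand w t).symm
  · exact (bumpPair_expand _ t).symm

/-- the frequency-`(1,1,1,1)` coefficient of `F_w`: `e(−w)/4 · P`, `P = ∏_{f ≠ f₀} conj(z_{s f})/2`. -/
theorem prod_cvec_one (f₀ : Fin 4) (w : ZMod 4) (s : Fin 4 → ZMod 4) :
    ∏ f, cvec f₀ w s f 1 = e (-w) / 4 * ∏ f ∈ Finset.univ.erase f₀, (starRingEnd ℂ) (zPair (s f)) / 2 := by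
  rw [← Finset.mul_prod_erase _ _ (Finset.mem_univ f₀)]
  congr 1
  · simp [cvec, coefFree_one]
  · exact Finset.prod_congr rfl fun f hf => by simp [cvec, Finset.ne_of_mem_erase hf, coefPair_one]

/-- Four rotated half-planes meet in `0`. -/
theorem eq_zero_of_re_rot_nonpos (z : ℂ) (h0 : (1 * z).re ≤ 0) (h1 : (Complex.I * z).re ≤ 0)
    (h2 : (-1 * z).re ≤ 0) (h3 : (-Complex.I * z).re ≤ 0) : z = 0 := by
  apply Complex.ext <;> simp at h0 h1 h2 h3 ⊢ <;> linarith

/-- **One rotation `w`**: `Re( (∏_f c_f(1)) · μ ) ≤ 0`. -/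
theorem rot_step (ω : PT → ℝ) (A : Finset PT) (hω : ∀ τ, τ ∉ A → ω τ ≤ 0)
    (hK : ∀ k, KAdm k → moment ω k = 0) (f₀ : Fin 4) (s : Fin 4 → ZMod 4)
    (hbox : ∀ a ∈ A, ∃ f, f ≠ f₀ ∧ (a f = s f ∨ a f = s f + 1)) (w : ZMod 4) :
    ((∏ f, cvec f₀ w s f 1) * moment ω (fun _ => 1)).re ≤ 0 := by
  -- the pairing of ω with F_w, expanded and reduced to the two top moments
  have hS := pairing_expansion ω (cvec f₀ w s)
  have hred : ∑ k : PT, (∏ f, cvec f₀ w s f (k f)) * moment ω k =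
      (∏ f, cvec f₀ w s f 1) * moment ω (fun _ => 1) + (∏ f, cvec f₀ w s f 3) * moment ω (fun _ => 3) := by
    have hne : (fun _ => (1 : ZMod 4) : PT) ≠ (fun _ => 3) := fun h => absurd (congr_fun h 0) (by decide)
    rw [Finset.sum_eq_add (fun _ => (1 : ZMod 4)) (fun _ => (3 : ZMod 4)) hne]
    · intro k _ hk
      by_cases h : ∃ f, k f = 2
      · obtain ⟨f, hf⟩ := h
        rw [Finset.prod_eq_zero (Finset.mem_univ f) (by rw [hf, cvec_two]), zero_mul]
      · rw [hK k ⟨fun f hf => h ⟨f, hf⟩, hk.1, hk.2⟩, mul_zero]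
    · intro h; exact absurd (Finset.mem_univ _) h
    · intro h; exact absurd (Finset.mem_univ _) h
  have hc3 : ∏ f, cvec f₀ w s f 3 = (starRingEnd ℂ) (∏ f, cvec f₀ w s f 1) := by
    rw [map_prod]; exact Finset.prod_congr rfl fun f _ => cvec_three f₀ w s f
  rw [hred, hc3, moment_three_eq_conj_moment_one, ← map_mul, Complex.add_conj] at hS
  -- the pairing is a real number ≤ 0
  have hreal : ∑ τ : PT, (ω τ : ℂ) * ∏ f, (∑ j : ZMod 4, cvec f₀ w s f j * Complex.I ^ ((j * τ f).val)) =
      ((∑ τ : PT, ω τ * ∏ f, vvec f₀ w s f (τ f) : ℝ) : ℂ) := by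
    push_cast
    refine Finset.sum_congr rfl fun τ _ => ?_
    congr 1
    exact Finset.prod_congr rfl fun f _ => trig_cvec f₀ w s f (τ f)
  have hnonpos : ∑ τ : PT, ω τ * ∏ f, vvec f₀ w s f (τ f) ≤ 0 := by
    apply Finset.sum_nonpos
    intro τ _
    by_cases hτ : τ ∈ A
    · obtain ⟨f, hf, hval⟩ := hbox τ hτ
      have h0 : ∏ f, vvec f₀ w s f (τ f) = 0 := by
        apply Finset.prod_eq_zero (Finset.mem_univ f)
        unfold vvec
        rw [if_neg hf]
        exact bumpPair_eq_zero hval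
      rw [h0, mul_zero]
    · exact mul_nonpos_iff.2 (Or.inr ⟨hω τ hτ, Finset.prod_nonneg fun f _ => vvec_nonneg f₀ w s f (τ f)⟩)
  rw [hreal] at hS
  have h2 : (∑ τ : PT, ω τ * ∏ f, vvec f₀ w s f (τ f)) =
      2 * ((∏ f, cvec f₀ w s f 1) * moment ω (fun _ => 1)).re := by exact_mod_cast hS
  linarith


/-- **The phase-torus law holds** (kernel target; pen ×2). -/
theorem phaseTorusLaw_holds : PhaseTorusLaw := by
  intro ω A hA hω hK
  obtain ⟨f₀, s, hbox⟩ := coveringLemmaBox_holds A hA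
  set P : ℂ := ∏ f ∈ Finset.univ.erase f₀, (starRingEnd ℂ) (zPair (s f)) / 2 with hP
  have hPne : P ≠ 0 := Finset.prod_ne_zero_iff.2 fun f _ =>
    div_ne_zero ((map_ne_zero _).2 (zPair_ne_zero _)) (by norm_num)
  -- the four rotations
  have key : ∀ w : ZMod 4, (e (-w) * (P * moment ω (fun _ => 1) / 4)).re ≤ 0 := by
    intro w
    have h := rot_step ω A hω hK f₀ s hbox w
    rw [prod_cvec_one] at h
    have hrw : e (-w) / 4 * P * moment ω (fun _ => 1) = e (-w) * (P * moment ω (fun _ => 1) / 4) := by ring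
    rw [hrw] at h
    exact h
  have hz : P * moment ω (fun _ => 1) / 4 = 0 := by
    apply eq_zero_of_re_rot_nonpos
    · have := key 0; rwa [neg_zero, e_zero] at this
    · have := key 3; rwa [show (-3 : ZMod 4) = 1 from by decide, e_one] at this
    · have := key 2; rwa [show (-2 : ZMod 4) = 2 from by decide, e_two] at this
    · have := key 1; rwa [show (-1 : ZMod 4) = 3 from by decide, e_three] at this
  have h4 : (4 : ℂ) ≠ 0 := by norm_num
  rcases mul_eq_zero.1 ((div_eq_zero_iff.1 hz).resolve_right h4) with h | h
  · exact absurd h hPne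
  · exact h

/-- Former stub of the crux workfile `PhaseTorusLaw.lean` v1/v2 (name kept for downstream references): the law holds. -/
theorem stub_phaseTorusLaw : PhaseTorusLaw := phaseTorusLaw_holds


end Summit.Ventures.HSemireg.PhaseTorus
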